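import Literature.RepresentationTheory.Paul1998.UnitaryDetCover
import Literature.RepresentationTheory.KonnoKonno2007.RealUnitaryDualPair
import HarnessLib

/-!
# The det-cover datum of the real unitary dual pair `(U(P,Q), U(R,S))` in `Sp(𝕎)` — instance side (kernel only)

Companion to `Literature.RepresentationTheory.Paul1998.UnitaryDetCover` (the RECORD
`DualPairCoverDatum.DetCoverLifting`, [A. Paul, *Howe correspondence for real unitary groups*,
J. Funct. Anal. 159 (1998), §1.2 (1.2.1)–(1.2.2), p. 389]).  This file contains NO cited statement and NO
`def … : Prop`: it fills the GROUP-SIDE fields of the abstract datum `DualPairCoverDatum p q r s nV nW Sp Mp`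
by the tree's constructed objects and discharges their obligations by kernel proofs.

* `Sp` := `symplecticGroup (polar (dotPairing (DPIdx P Q R S)))` — the symplectic group of
  `𝕎 = V ⊗_ℂ W` in the tree's block coordinates, i.e. the target of the junction map
  `KonnoKonno2007.RealDualPair.ι𝕎 P Q R S : U(P,Q) × U(R,S) →* Sp(𝕎)` of
  `Literature.RepresentationTheory.KonnoKonno2007.RealUnitaryDualPair` (= the `ι𝕎` field of
  `KonnoKonno2007.RealDualPair.junction P Q R S : RealDualPairJunction P Q R S _`);
* `GV` := `unitaryGroupOfForm (starRingEnd ℂ) (signForm P Q) ≤ GL_{P ⊕ Q}(ℂ)` and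
  `GW` := `unitaryGroupOfForm (starRingEnd ℂ) (signForm R S)`, so that `↥GV = UForm P Q`, `↥GW = UForm R S`
  are LITERALLY the junction carriers (`Ginf P Q R S = UForm P Q × UForm R S`);
* `ιV g := ι𝕎 (g, 1)`, `ιW h := ι𝕎 (1, h)` — print's `ι_J` restricted to the two members — with
  `ιV g * ιW h = ι𝕎 (g, h)` (`ιV_mul_ιW`) and the injectivity obligations `ιV_injective`, `ιW_injective`
  PROVED (each needs the other space to be non-zero: `Nonempty (R ⊕ S)`, resp. `Nonempty (P ⊕ Q)`);
* `card_V : |P ⊕ Q| = |P| + |Q|`, `card_W` by `Fintype.card_sum`, so the record's exponents read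
  `r − s = |R| − |S|` on the `U(P,Q)`-side cover and `p − q = |P| − |Q|` on the `U(R,S)`-side cover, as printed.

The COVER-SIDE fields (`Mp`, `pr`, `ε` with `pr` surjective, `pr ε = 1`, `ε ≠ 1`, `ker pr = {1, ε}`) stay
ARGUMENTS of the constructor `coverDatum`: the tree has, as of this file, no archimedean two-fold metaplectic
GROUP over `Sp(𝕎)`; whoever constructs one (object-match duty "Mp" of the record's docstring) obtains the datum
by `coverDatum P Q R S pr hpr ε hε hε₁ hker`, and the record then reads
`(coverDatum …).DetCoverLifting` with `pr (L (x, y)) = ι𝕎 (x.1.1, y.1.1)` (`pr_lifting_eq_ι𝕎`).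

Of the record's three OBJECT-MATCH DUTIES (module docstring of `UnitaryDetCover`), this file discharges
"Sp" (:= the target of `RealDualPairJunction.ι𝕎`) and "GV × GW" (:= the junction carriers) BY CONSTRUCTION;
"Mp" (the constructed metaplectic two-fold cover with its `pr`, `ε`) remains with the caller of `coverDatum`.

Transcription level: none (kernel file).  Tags: `[folklore]` throughout; the two `[cite: …]` tags only
record PROVENANCE of the objects (which paper's map is being instantiated), not cited facts.

References: [Paul1998] A. Paul, Howe correspondence for real unitary groups, J. Funct. Anal. 159 (1998)
384–431, §1.1 (1.1.2) p. 388 L62–64 (`ι_J : U(V) × U(W) → Sp(W_ℝ)`), §1.2 p. 389; [KonnoKonno2007] T. Konno,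
K. Konno, Kyushu J. Math. 61 (2007), §3.1 (3.1) (the dual-pair map realised by `RealDualPair.ι𝕎`).
-/

noncomputable section

open Matrix Complex
open scoped Kronecker ComplexConjugate
open Literature.Analysis.SegalBargmann Literature.RepresentationTheory.HeisenbergGroup
open Literature.NumberTheory.Automorphic Literature.NumberTheory.Automorphic.UnitaryGroup
open Literature.RepresentationTheory.KonnoKonno2007
open Literature.RepresentationTheory.KonnoKonno2007.RealDualPair

namespace Literature.RepresentationTheory.Paul1998

namespace UnitaryDualPairCover

/-! ## 1. The twisted realification is injective -/

section Twist

variable {α β : Type*} [Fintype α] [DecidableEq α] [Fintype β] [DecidableEq β]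

omit [Fintype α] [DecidableEq α] [Fintype β] [DecidableEq β] in
/-- `tw` is injective (it is an involution). [folklore] -/
theorem tw_injective : Function.Injective (tw : (α ⊕ β → ℂ) → α ⊕ β → ℂ) :=
  Function.LeftInverse.injective tw_tw

/-- **A complex matrix is determined by its twisted realification** `(p, q) ↦ (Re, Im)(tw (M (tw (p + iq))))`.
[folklore] -/
theorem twRealify_injective :
    Function.Injective (twRealify : Matrix (α ⊕ β) (α ⊕ β) ℂ → PhaseMap (α ⊕ β)) := by
  intro M M' h
  -- `twMulVec M z = twMulVec M' z` for every complex vector `z`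
  have hz : ∀ z : α ⊕ β → ℂ, twMulVec M z = twMulVec M' z := by
    intro z
    have hre : phasePt (fun k => (z k).re) (fun k => (z k).im) = z := phasePt_re_im z
    have h1 := phasePt_twRealify M (fun k => (z k).re, fun k => (z k).im)
    have h2 := phasePt_twRealify M' (fun k => (z k).re, fun k => (z k).im)
    rw [h] at h1
    dsimp only at h1 h2
    rw [hre] at h1 h2
    exact h1.symm.trans h2
  -- hence `M y = M' y` for every `y`
  have hy : ∀ y : α ⊕ β → ℂ, M *ᵥ y = M' *ᵥ y := by
    intro y
    have := hz (tw y)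
    simp only [twMulVec, tw_tw] at this
    exact tw_injective this
  have hlin : Matrix.toLin' M = Matrix.toLin' M' :=
    LinearMap.ext fun y => by rw [Matrix.toLin'_apply, Matrix.toLin'_apply, hy]
  exact Matrix.toLin'.injective hlin

end Twist

/-! ## 2. `ι_J` restricted to the two members, and its injectivity -/

section Pair

variable (P Q R S : Type*) [Fintype P] [DecidableEq P] [Fintype Q] [DecidableEq Q] [Fintype R] [DecidableEq R]
  [Fintype S] [DecidableEq S]

/-- `Sp(𝕎)` in the tree's block coordinates `DPIdx P Q R S` (the target of the junction map `ι𝕎`). [folklore] -/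
abbrev SpW : Type _ := ↥(symplecticGroup (polar (dotPairing (DPIdx P Q R S))))

/-- **`ι_V : U(P,Q) →* Sp(𝕎)`, `g ↦ ι𝕎 (g, 1)`** — print's `ι_J` on the first member.
[cite: Paul1998, §1.1 (1.1.2) p. 388 L62–64] -/
def ιV : UForm P Q →* SpW P Q R S :=
  (ι𝕎 P Q R S).comp (MonoidHom.inl (UForm P Q) (UForm R S))

/-- **`ι_W : U(R,S) →* Sp(𝕎)`, `h ↦ ι𝕎 (1, h)`** — print's `ι_J` on the second member.
[cite: Paul1998, §1.1 (1.1.2) p. 388 L62–64] -/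
def ιW : UForm R S →* SpW P Q R S :=
  (ι𝕎 P Q R S).comp (MonoidHom.inr (UForm P Q) (UForm R S))

variable {P Q R S}

/-- Unfolding. [folklore] -/
@[simp] theorem ιV_apply (g : UForm P Q) : ιV P Q R S g = ι𝕎 P Q R S (g, 1) := rfl

/-- Unfolding. [folklore] -/
@[simp] theorem ιW_apply (h : UForm R S) : ιW P Q R S h = ι𝕎 P Q R S (1, h) := rfl

/-- **`ι_V(g) · ι_W(h) = ι𝕎(g, h)`**: the two restrictions multiply back to the dual-pair map. [folklore] -/
theorem ιV_mul_ιW (g : UForm P Q) (h : UForm R S) : ιV P Q R S g * ιW P Q R S h = ι𝕎 P Q R S (g, h) := by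
  rw [ιV_apply, ιW_apply, ← map_mul, Prod.mk_mul_mk, mul_one, one_mul]

/-- `ι_V(g)` and `ι_W(h)` commute. [folklore] -/
theorem commute_ιV_ιW (g : UForm P Q) (h : UForm R S) : Commute (ιV P Q R S g) (ιW P Q R S h) := by
  show ιV P Q R S g * ιW P Q R S h = ιW P Q R S h * ιV P Q R S g
  rw [ιV_mul_ιW, ιV_apply, ιW_apply, ← map_mul, Prod.mk_mul_mk, mul_one, one_mul]

/-- The matrix `reindex (g_V ⊗ g_W)` is recovered from `ι𝕎 (g_V, g_W)`. [folklore] -/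
theorem reindex_kronecker_eq_of_ι𝕎_eq {g g' : Ginf P Q R S} (h : ι𝕎 P Q R S g = ι𝕎 P Q R S g') :
    Matrix.reindex (dpEquiv P Q R S) (dpEquiv P Q R S)
        (((g.1 : GL (P ⊕ Q) ℂ) : Matrix (P ⊕ Q) (P ⊕ Q) ℂ) ⊗ₖ ((g.2 : GL (R ⊕ S) ℂ) : Matrix (R ⊕ S) (R ⊕ S) ℂ)) =
      Matrix.reindex (dpEquiv P Q R S) (dpEquiv P Q R S)
        (((g'.1 : GL (P ⊕ Q) ℂ) : Matrix (P ⊕ Q) (P ⊕ Q) ℂ) ⊗ₖ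
          ((g'.2 : GL (R ⊕ S) ℂ) : Matrix (R ⊕ S) (R ⊕ S) ℂ)) := by
  apply twRealify_injective
  funext w
  rw [← ι𝕎_apply, ← ι𝕎_apply, h]

/-- **`ι_V` is injective** as soon as `W ≠ 0`. [folklore] -/
theorem ιV_injective [Nonempty (R ⊕ S)] : Function.Injective (ιV P Q R S) := by
  intro g g' h
  obtain ⟨k⟩ := ‹Nonempty (R ⊕ S)›
  have hM := (Matrix.reindex _ _).injective (reindex_kronecker_eq_of_ι𝕎_eq (g := (g, 1)) (g' := (g', 1)) h)
  apply Subtype.ext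
  apply Units.ext
  ext i j
  have hij := congr_fun (congr_fun hM (i, k)) (j, k)
  simpa [Matrix.kroneckerMap_apply] using hij

/-- **`ι_W` is injective** as soon as `V ≠ 0`. [folklore] -/
theorem ιW_injective [Nonempty (P ⊕ Q)] : Function.Injective (ιW P Q R S) := by
  intro g g' h
  obtain ⟨i⟩ := ‹Nonempty (P ⊕ Q)›
  have hM := (Matrix.reindex _ _).injective (reindex_kronecker_eq_of_ι𝕎_eq (g := (1, g)) (g' := (1, g')) h)
  apply Subtype.ext
  apply Units.ext
  ext k l
  have hkl := congr_fun (congr_fun hM (i, k)) (i, l)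
  simpa [Matrix.kroneckerMap_apply] using hkl

/-! ## 3. The datum over an arbitrary two-fold cover of `Sp(𝕎)` -/

variable (P Q R S)
variable {Mp : Type*} [Group Mp]

/-- **The det-cover datum of `(U(P,Q), U(R,S))` over a two-fold cover `pr : Mp ↠ Sp(𝕎)` with kernel `{1, ε}`.**
Group side = the tree's junction carriers and `ι𝕎`; cover side = the arguments. [folklore] -/
def coverDatum [Nonempty (P ⊕ Q)] [Nonempty (R ⊕ S)] (pr : Mp →* SpW P Q R S)
    (hpr : Function.Surjective pr) (ε : Mp) (hε : pr ε = 1) (hε₁ : ε ≠ 1)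
    (hker : ∀ m, pr m = 1 → m = 1 ∨ m = ε) :
    DualPairCoverDatum (Fintype.card P) (Fintype.card Q) (Fintype.card R) (Fintype.card S) (P ⊕ Q) (R ⊕ S)
      (SpW P Q R S) Mp where
  card_V := Fintype.card_sum
  card_W := Fintype.card_sum
  GV := unitaryGroupOfForm (starRingEnd ℂ) (signForm P Q)
  GW := unitaryGroupOfForm (starRingEnd ℂ) (signForm R S)
  pr := pr
  pr_surjective := hpr
  ε := ε
  pr_ε := hε
  ε_ne_one := hε₁
  eq_one_or_eq_ε := hker
  ιV := ιV P Q R S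
  ιW := ιW P Q R S
  ιV_injective := UnitaryDualPairCover.ιV_injective
  ιW_injective := UnitaryDualPairCover.ιW_injective

section Fields

variable [Nonempty (P ⊕ Q)] [Nonempty (R ⊕ S)] (pr : Mp →* SpW P Q R S) (hpr : Function.Surjective pr)
  (ε : Mp) (hε : pr ε = 1) (hε₁ : ε ≠ 1) (hker : ∀ m, pr m = 1 → m = 1 ∨ m = ε)

/-- field. [folklore] -/
@[simp] theorem coverDatum_GV :
    (coverDatum P Q R S pr hpr ε hε hε₁ hker).GV = unitaryGroupOfForm (starRingEnd ℂ) (signForm P Q) := rfl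

/-- field. [folklore] -/
@[simp] theorem coverDatum_GW :
    (coverDatum P Q R S pr hpr ε hε hε₁ hker).GW = unitaryGroupOfForm (starRingEnd ℂ) (signForm R S) := rfl

/-- field. [folklore] -/
@[simp] theorem coverDatum_pr : (coverDatum P Q R S pr hpr ε hε hε₁ hker).pr = pr := rfl

/-- field. [folklore] -/
@[simp] theorem coverDatum_ε : (coverDatum P Q R S pr hpr ε hε hε₁ hker).ε = ε := rfl

/-- field. [folklore] -/
@[simp] theorem coverDatum_ιV : (coverDatum P Q R S pr hpr ε hε hε₁ hker).ιV = ιV P Q R S := rfl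

/-- field. [folklore] -/
@[simp] theorem coverDatum_ιW : (coverDatum P Q R S pr hpr ε hε hε₁ hker).ιW = ιW P Q R S := rfl

/-- **`Ũ(P,Q) := pr⁻¹(ι𝕎 (U(P,Q) × 1))`**: membership in the inverse image of the first member. [folklore] -/
theorem mem_coverV_iff (m : Mp) :
    m ∈ (coverDatum P Q R S pr hpr ε hε hε₁ hker).coverV ↔ ∃ g : UForm P Q, ι𝕎 P Q R S (g, 1) = pr m :=
  (coverDatum P Q R S pr hpr ε hε hε₁ hker).mem_coverV_iff

/-- **`Ũ(R,S) := pr⁻¹(ι𝕎 (1 × U(R,S)))`**. [folklore] -/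
theorem mem_coverW_iff (m : Mp) :
    m ∈ (coverDatum P Q R S pr hpr ε hε hε₁ hker).coverW ↔ ∃ h : UForm R S, ι𝕎 P Q R S (1, h) = pr m :=
  (coverDatum P Q R S pr hpr ε hε hε₁ hker).mem_coverW_iff

/-- **Object match for a det-cover lifting over this datum**: `pr (L (x, y)) = ι𝕎 (x.1.1, y.1.1)` — the lifting
covers the junction's dual-pair map `ι𝕎` itself. [folklore] -/
theorem pr_lifting_eq_ι𝕎
    {L : detCover (coverDatum P Q R S pr hpr ε hε hε₁ hker).GV ((Fintype.card R : ℤ) - Fintype.card S) ×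
        detCover (coverDatum P Q R S pr hpr ε hε hε₁ hker).GW ((Fintype.card P : ℤ) - Fintype.card Q) →* Mp}
    (h : (coverDatum P Q R S pr hpr ε hε hε₁ hker).IsDetCoverLifting L) (x y) :
    pr (L (x, y)) = ι𝕎 P Q R S (x.1.1, y.1.1) :=
  (h.pr_apply x y).trans (ιV_mul_ιW x.1.1 y.1.1)

/-- The record over this datum, unfolded: a det-cover lifting of the junction pair exists. [folklore] -/
theorem detCoverLifting_iff [TopologicalSpace Mp] :
    (coverDatum P Q R S pr hpr ε hε hε₁ hker).DetCoverLifting ↔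
      ∃ L : detCover (unitaryGroupOfForm (starRingEnd ℂ) (signForm P Q)) ((Fintype.card R : ℤ) - Fintype.card S) ×
          detCover (unitaryGroupOfForm (starRingEnd ℂ) (signForm R S)) ((Fintype.card P : ℤ) - Fintype.card Q) →* Mp,
        Continuous L ∧ (coverDatum P Q R S pr hpr ε hε hε₁ hker).IsDetCoverLifting L :=
  Iff.rfl

end Fields

end Pair

end UnitaryDualPairCover

end Literature.RepresentationTheory.Paul1998

end
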